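import Mathlib.Algebra.QuadraticDiscriminant
import Literature.MathematicalPhysics.StatisticalMechanics.ComplexSpinReflectionPositivity
import Literature.MathematicalPhysics.StatisticalMechanics.NJLExponentialClustering
import Literature.MathematicalPhysics.StatisticalMechanics.NJLTwoPointThermodynamicLimit
import Literature.MathematicalPhysics.StatisticalMechanics.NJLChiralCondensateLowerBound
import Literature.MathematicalPhysics.StatisticalMechanics.ComplexSpinCorrelationBound
import HarnessLib

/-!
# Prefactor-free clustering of the NJL two-point function at real mass
# (Salmhofer–Seiler, Erratum CMP 146 (1992) 637–638, (5)–(9): reflection positivity and the transfer operator)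

Salmhofer–Seiler, Erratum p. 637: "For real `m ≠ 0` and the two-point function we can get rid of
`B₂(m)`: `|⟨σ_0σ_x⟩ - ⟨σ_0⟩⟨σ_x⟩| ≤ e^{-κ(m)|x|}` (5) where `|x| = max_i |x_i|`.  This can be seen
as follows: let `m ∈ ℝ`.  Denoting `𝔏₊ = {L : supp L ⊂ {x ∈ ℤ^ν : x₁ ≥ 0}}`, our physical Hilbert
space is the space of equivalence classes of sequences in `l¹(𝔏₊)` with scalar product (cf.
Definition 3.14) `(w, z) = ∑_{L,L'∈𝔏₊} ā_L b_{L'} ⟨Θ(σ^L) σ^{L'}⟩` (6) … We denote the transfer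
operator corresponding to translations by `2e₁` by `T₁`, then `0 ≤ T₁ ≤ 1` …, and `T₁* = T₁`, so
the spectrum `σ(T₁) ⊂ [0, 1]`.  By translation invariance, `Ω` … is an eigenvector of `T₁` with
eigenvalue `1`. … for all `L, M`, `|⟨σ^Lσ^M⟩ - ⟨σ^L⟩⟨σ^M⟩| ≤ C(m,L,M) e^{-κ(m)d(L,M)}` (7) … For
all `w, z ∈ 𝒟` and all `t ∈ ℕ`, `|(w, (T₁ᵗ - P_Ω) z)| ≤ c(m,w,z) e^{-κt}` (8), which implies that
for all `f ∈ 𝒟`: `P_{(e^{-κ},1)} f = 0`.  Since `𝒟` is dense, `σ(T₁) ∖ {1} ⊂ [0, e^{-κ}]`.  Let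
`x₁ ∈ 2ℕ`, then `|⟨σ_0σ_x⟩ - ⟨σ_0⟩⟨σ_x⟩| = |(ψ, (T₁^{x₁/2} - P_Ω) ∏_{i≥2} T_i^{x_i} ψ)| ≤ ‖ψ‖²
e^{-κx₁/2}` (9) (`ψ` is the state corresponding to `σ_0` …).  Using the discrete rotational
symmetry, we can repeat this argument for all other directions and get the bound.  If `x_i` is
not even for some `i`, the Schwarz inequality has to be applied once before proceeding …"

This file proves (5) for the tree's NJL system (`ComplexSpinInfraredBound`: the β = 0 effective
complex-spin model of Def. 3.1/3.3 on the tori `(ℤ/L)^ν`) in the INFINITE VOLUME, following the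
Erratum's road with one simplification: the spectral theorem for `T₁` is replaced by the
log-convexity of `n ↦ (ψ, T₁ⁿψ)` (symmetry + positivity of `T₁` + Schwarz), which turns the
`m`-dependent prefactor of Thm. 3.11 into `‖(1 - P_Ω)ψ‖²` exactly as "`σ(T₁)∖{1} ⊂ [0,e^{-κ}]`"
does.

1. `RPTransfer.IsRPState` — the data (6): a linear state `ω`, the reflection `θ`, the one-step
   translation `τ` across the plane and the half-space algebra `S`, with RP, symmetry and
   `ω(τa·θb) = ω(a·θ(τb))`; `corr ω θ τ a n = ω(a·θ(τ^{2n}a)) = (ψ_a, T₁ⁿψ_a)`.  Proved: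
   `shift_pow` (`T₁` symmetric), `sq_le` (Schwarz, Remark 3.16 (3.54)), `corr_nonneg` (`T₁ ≥ 0`),
   `corr_sq_le` (log-convexity), `cross_sq_le`; the real-sequence lemma
   `le_head_of_logConvex_of_bounded` / `le_head_mul_pow_of_logConvex` (a bounded nonnegative
   log-convex sequence is `≤` its first term; with a rate: `u n ≤ C rⁿ ⇒ u n ≤ u 0 · rⁿ`), hence
   `corr_le` and `abs_cross_le` ((8) ⇒ (9)).
2. The infinite-volume NJL state `njlState N m P = lim_L ⟨P read on Λ_L⟩_{Λ_L}` on the real local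
   observables `MvPolynomial (ℤ^ν) ℝ` (`tendsto_njlState`: for real `m ≠ 0` the limit exists along
   every sequence of tori and is the same — Thm. 3.8/Cor. 3.9 of the tree, `NJLThermodynamicLimit`,
   extended from monomials by linearity), its linearity (`njlStateL`), `⟨1⟩ = 1`, translation
   invariance (`njlState_rename_add`), reflection invariance (`njlState_rename_latReflect`, the
   reflection `latReflect μ` of `ℤ^ν` in the plane `x_μ = -1/2` — on the torus the tree's
   `siteReflect μ 0`), and REFLECTION POSITIVITY `⟨A·ΘA⟩ ≥ 0` for `A` localised in `{x_μ ≥ 0}`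
   (`njlState_mul_reflect_nonneg`: the tree's Prop. 3.15 `expect_mul_reflectR_nonneg` on the even
   tori, passed to the limit); packaged as `isRPState_njlState` with `τ` = translation by `e_μ`.
3. `abs_njlTwoPoint_sub_sq_le` — Thm. 3.11 in the limit with prefactor (the tree's
   `njl_twoPoint_exponentialClustering_limit`); `njlTwoPoint_single_le_half` — `T(e_μ) ≤ 1/2` from
   the Schwinger–Dyson identity (4.10) `1 = 2m⟨σ_0⟩ + ∑_{|y|=1}⟨σ_0σ_y⟩` and Thm. 3.18 (1);
   `abs_njlTwoPoint_sub_sq_le_one` — `|T(x) - s²| ≤ 1` (Thm. 3.18 (1)).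
4. `abs_njlTwoPoint_sub_sq_le_transfer` — (9): `|T(x) - s²| ≤ (T(e_μ) - s²) e^{-κ(x_μ-1)}` for
   `x_μ ≥ 1`, with `ψ ↔ σ_0 - s` (so `P_Ω` is already removed and `‖ψ‖² = T(e_μ) - s²`), the
   observable `σ_{x'} - s` resp. `σ_{x'+e_μ} - s` on the other side ("the Schwarz inequality has to
   be applied once" for even `x_μ`), spatial translations acting inside the half space.
5. `njl_twoPoint_clustering_prefactorFree` — **(5)**: `∃ κ(m) > 0, ∀ x ∀ i, |T(x) - s²| ≤
   e^{-κ(m)|x_i|}` (`κ(m) = min(κ_{3.11}(m), log 2)`; `x_i < 0` by `T(-x) = T(x)`, `x_i = 0` by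
   `|T - s²| ≤ 1`); `njl_twoPoint_clustering_prefactorFree_limit` — the same for the limits along
   any sequence of tori, in the vocabulary of `njl_twoPoint_thermodynamicLimit`.

Faithfulness / scope.  (i) The print has real `m ≠ 0`; proved here for `m > 0` (the tree's
positivity results `Z_Λ > 0`, `0 ≤ ⟨σ^L⟩_Λ ≤ 1` are stated for `m ≥ 0`) — TODO(general form):
`m < 0` is the image under `σ ↦ -σ`.  (ii) Volumes: the infinite-volume state is the limit along
tori (the tree's Thm. 3.8), the print's `𝔏` is `ℤ^ν` with van Hove limits; the limit state is the
object the Erratum's Hilbert space (6) is built from, and RP is used only through the limit of the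
torus inequalities of Prop. 3.15 with the reflection plane between lattice hyperplanes (Def. 3.13),
so `Θσ_0 = σ_{-e_μ}` and `‖ψ_{σ_0}‖² = T(e_μ)`: the print's (9) is off by one lattice unit in
`x₁`, immaterial for (5).  (iii) The rate: the print's `κ(m)` in (5) is "a" positive constant; here
`min(κ(m), log 2)` with `κ(m)` the rate of the tree's Thm. 3.11, the `log 2` absorbing
`‖(1-P_Ω)ψ‖² ≤ 1/2` at `|x| = 1`.  (iv) No Hilbert space completion, no spectral theorem: (8) ⇒ (9)
is done by log-convexity, an equivalent road for the matrix elements needed.  (v) Honest framing: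
β = 0 NJL statements; nothing about β > 0, the continuum, a mass gap of a gauge theory or the
summit's `QCD` conjunct.  Remark 3.12 / Cor. 4.4 (4) ((4.19), `κ(m) ≤ const·m^{1/ν}`), which the
Erratum says rest on (5), are not in this file.

## References

* M. Salmhofer, E. Seiler, Erratum: *Proof of chiral symmetry breaking in strongly coupled lattice
  gauge theory*, Commun. Math. Phys. 146 (1992) 637–638: (5)–(9). [SalmhoferSeiler1992Erratum]
* M. Salmhofer, E. Seiler, *Proof of chiral symmetry breaking in strongly coupled lattice gauge
  theory*, Commun. Math. Phys. 139 (1991) 395–432: Def. 3.13–3.14, Prop. 3.15, Remark 3.16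
  (pp. 410–411), Thm. 3.8, Cor. 3.9, Thm. 3.11 (p. 407), Thm. 3.18 (1), (4.10). [SalmhoferSeiler1991]
* S. Friedli, Y. Velenik, *Statistical Mechanics of Lattice Systems*, CUP 2017, §3.1 and Ch. 10
  (torus, reflections). [FriedliVelenik2017]
-/

noncomputable section

open Filter Topology MvPolynomial

namespace Literature.MathematicalPhysics.StatisticalMechanics

/-! ### Reflection positivity with a compatible translation: the transfer-operator inequalities,
written on the observable algebra (Erratum (6)–(9)) -/

namespace RPTransfer

variable {A : Type*} [CommRing A] [Algebra ℝ A]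

/-- **The data of Erratum (6).**  A linear functional `ω` on a commutative real observable algebra,
an algebra endomorphism `θ` (the reflection `Θ`), an algebra endomorphism `τ` (translation by ONE
lattice unit across the reflection plane) and a subalgebra `S` (the observables of the positive
half space `𝔏₊`) form an RP state with transfer step when: the sesquilinear form
`(a, b) ↦ ω(a · θb)` ((6)) is symmetric and nonnegative on `S` (reflection positivity), `τ` maps
`S` into itself, and `ω(τa · θb) = ω(a · θ(τb))` (translation invariance of `ω` together with
`θ ∘ τ = τ⁻¹ ∘ θ`).  The transfer operator `T₁` of the Erratum is induced by `τ²` (translation by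
`2e₁`). [cite: SalmhoferSeiler1992Erratum, (6) and the paragraph after it][cite: SalmhoferSeiler1991, Def. 3.14 and Remark 3.16] -/
structure IsRPState (ω : A →ₗ[ℝ] ℝ) (θ τ : A →ₐ[ℝ] A) (S : Subalgebra ℝ A) : Prop where
  symm : ∀ a b, ω (a * θ b) = ω (b * θ a)
  nonneg : ∀ a ∈ S, 0 ≤ ω (a * θ a)
  shift : ∀ a b, ω (τ a * θ b) = ω (a * θ (τ b))
  map_mem : ∀ a ∈ S, τ a ∈ S

/-- The diagonal matrix elements of the powers of the transfer operator `T = τ²`: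
`u_a(n) = (ψ_a, Tⁿ ψ_a) = ω(a · θ(τ^{2n} a))`. [cite: SalmhoferSeiler1992Erratum, (8)–(9)] -/
def corr (ω : A →ₗ[ℝ] ℝ) (θ τ : A →ₐ[ℝ] A) (a : A) (n : ℕ) : ℝ :=
  ω (a * θ ((τ ^ (2 * n)) a))

/-- `u_a(0) = (ψ_a, ψ_a) = ω(a · θa)`. [cite: SalmhoferSeiler1992Erratum, (6)] -/
theorem corr_zero (ω : A →ₗ[ℝ] ℝ) (θ τ : A →ₐ[ℝ] A) (a : A) : corr ω θ τ a 0 = ω (a * θ a) := by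
  simp [corr]

namespace IsRPState

variable {ω : A →ₗ[ℝ] ℝ} {θ τ : A →ₐ[ℝ] A} {S : Subalgebra ℝ A}

/-- `S` is stable under all translations `τⁿ`. [cite: SalmhoferSeiler1992Erratum, (6)] -/
theorem pow_mem (h : IsRPState ω θ τ S) {a : A} (ha : a ∈ S) (n : ℕ) : (τ ^ n) a ∈ S := by
  induction n with
  | zero => simpa using ha
  | succ n ih =>
    rw [pow_succ', AlgHom.mul_apply]
    exact h.map_mem _ ih

/-- **`T` is symmetric**: `ω(τᵖa · θ(τ^q b)) = ω(a · θ(τ^{p+q} b))` — translations move freely across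
the form. [cite: SalmhoferSeiler1992Erratum, after (6) ("`T₁* = T₁`")] -/
theorem shift_pow (h : IsRPState ω θ τ S) (a b : A) (p q : ℕ) :
    ω ((τ ^ p) a * θ ((τ ^ q) b)) = ω (a * θ ((τ ^ (p + q)) b)) := by
  induction p generalizing q with
  | zero => simp
  | succ p ih =>
    have hq : τ ((τ ^ q) b) = (τ ^ (q + 1)) b := by rw [pow_succ', AlgHom.mul_apply]
    rw [pow_succ', AlgHom.mul_apply, h.shift, hq, ih, show p + (q + 1) = p + 1 + q by ring]

/-- **The Schwarz inequality** for the form `(a, b) = ω(a · θb)` on `S` (Remark 3.16 (3.54)):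
`ω(a θb)² ≤ ω(a θa) ω(b θb)`. [cite: SalmhoferSeiler1991, Remark 3.16 (3.54)] -/
theorem sq_le (h : IsRPState ω θ τ S) {a b : A} (ha : a ∈ S) (hb : b ∈ S) :
    ω (a * θ b) ^ 2 ≤ ω (a * θ a) * ω (b * θ b) := by
  have hba : ω (b * θ a) = ω (a * θ b) := h.symm b a
  have hq : ∀ t : ℝ, 0 ≤ ω (b * θ b) * (t * t) + (-(2 * ω (a * θ b))) * t + ω (a * θ a) := by
    intro t
    have hmem : a - t • b ∈ S := S.sub_mem ha (S.smul_mem hb t)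
    have h0 := h.nonneg _ hmem
    have hexp : ω ((a - t • b) * θ (a - t • b)) =
        ω (a * θ a) - t * ω (a * θ b) - t * ω (b * θ a) + t * t * ω (b * θ b) := by
      simp only [map_sub, map_smul, sub_mul, mul_sub, smul_mul_assoc, mul_smul_comm, smul_sub,
        smul_eq_mul]
      ring
    rw [hexp, hba] at h0
    nlinarith [h0]
  have hd := discrim_le_zero hq
  rw [discrim] at hd
  nlinarith [hd]

/-- `u_a(n) = (τⁿa, Θ τⁿa) ≥ 0`: the transfer operator is positive
(`0 ≤ T₁`). [cite: SalmhoferSeiler1992Erratum, after (6) ("`0 ≤ T₁ ≤ 1`")] -/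
theorem corr_nonneg (h : IsRPState ω θ τ S) {a : A} (ha : a ∈ S) (n : ℕ) : 0 ≤ corr ω θ τ a n := by
  rw [corr, show 2 * n = n + n by ring, ← h.shift_pow a a n n]
  exact h.nonneg _ (h.pow_mem ha n)

/-- **Log-convexity of `n ↦ (ψ_a, Tⁿψ_a)`**: `u_a(i+j)² ≤ u_a(2i) u_a(2j)` (symmetry of `T` and the
Schwarz inequality). [cite: SalmhoferSeiler1992Erratum, (8)–(9)][cite: SalmhoferSeiler1991, Remark 3.16 (3.54)] -/
theorem corr_sq_le (h : IsRPState ω θ τ S) {a : A} (ha : a ∈ S) (i j : ℕ) :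
    corr ω θ τ a (i + j) ^ 2 ≤ corr ω θ τ a (2 * i) * corr ω θ τ a (2 * j) := by
  have h1 : corr ω θ τ a (i + j) = ω ((τ ^ (2 * i)) a * θ ((τ ^ (2 * j)) a)) := by
    rw [corr, h.shift_pow, show 2 * i + 2 * j = 2 * (i + j) by ring]
  have h2 : corr ω θ τ a (2 * i) = ω ((τ ^ (2 * i)) a * θ ((τ ^ (2 * i)) a)) := by
    rw [corr, h.shift_pow, show 2 * i + 2 * i = 2 * (2 * i) by ring]
  have h3 : corr ω θ τ a (2 * j) = ω ((τ ^ (2 * j)) a * θ ((τ ^ (2 * j)) a)) := by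
    rw [corr, h.shift_pow, show 2 * j + 2 * j = 2 * (2 * j) by ring]
  rw [h1, h2, h3]
  exact h.sq_le (h.pow_mem ha _) (h.pow_mem ha _)

/-- **Off-diagonal matrix elements**: `ω(a · θ(τ^{2n} b))² ≤ u_a(n) u_b(n)` for `a, b ∈ S`
(`(ψ_a, Tⁿψ_b) = (T^{n/2}ψ_a, T^{n/2}ψ_b)` resp. one more `τ` on each side, and Schwarz).
[cite: SalmhoferSeiler1992Erratum, (9) and the sentence after it][cite: SalmhoferSeiler1991, Remark 3.16 (3.54)] -/
theorem cross_sq_le (h : IsRPState ω θ τ S) {a b : A} (ha : a ∈ S) (hb : b ∈ S) (n : ℕ) :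
    ω (a * θ ((τ ^ (2 * n)) b)) ^ 2 ≤ corr ω θ τ a n * corr ω θ τ b n := by
  have h1 : ω (a * θ ((τ ^ (2 * n)) b)) = ω ((τ ^ n) a * θ ((τ ^ n) b)) := by
    rw [h.shift_pow, show n + n = 2 * n by ring]
  have h2 : corr ω θ τ a n = ω ((τ ^ n) a * θ ((τ ^ n) a)) := by
    rw [corr, h.shift_pow, show n + n = 2 * n by ring]
  have h3 : corr ω θ τ b n = ω ((τ ^ n) b * θ ((τ ^ n) b)) := by
    rw [corr, h.shift_pow, show n + n = 2 * n by ring]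
  rw [h1, h2, h3]
  exact h.sq_le (h.pow_mem ha _) (h.pow_mem hb _)

end IsRPState

/-- **The spectral-gap step without the spectral theorem.**  A nonnegative log-convex sequence
(`v(i+j)² ≤ v(2i) v(2j)`) that is bounded is non-increasing from its first term: `v n ≤ v 0`.
(If `v n > v 0`, then `v(2^k n) ≥ v 0 (v n / v 0)^{2^k} → ∞`.)  This replaces the Erratum's
"`(e^{-κ}, 1) ∌ σ(T₁)`" argument ((8) ⇒ `P_{(e^{-κ},1)} f = 0`). [cite: SalmhoferSeiler1992Erratum, (8)–(9)] -/
theorem le_head_of_logConvex_of_bounded {v : ℕ → ℝ} (h0 : ∀ n, 0 ≤ v n)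
    (hconv : ∀ i j, v (i + j) ^ 2 ≤ v (2 * i) * v (2 * j)) {C : ℝ} (hC : ∀ n, v n ≤ C) (n : ℕ) :
    v n ≤ v 0 := by
  by_contra hlt
  rw [not_le] at hlt
  have hsq : ∀ k, v k ^ 2 ≤ v 0 * v (2 * k) := fun k => by simpa using hconv 0 k
  rcases (h0 0).eq_or_lt with h00 | h00
  · have h1 := hsq n
    rw [← h00, zero_mul] at h1
    have h2 : v n = 0 := pow_eq_zero_iff (n := 2) (by norm_num) |>.1 (le_antisymm h1 (sq_nonneg _))
    linarith [h0 n]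
  · set ρ : ℝ := v n / v 0 with hρ
    have hρ1 : 1 < ρ := by rw [hρ, lt_div_iff₀ h00]; linarith
    have hiter : ∀ k : ℕ, v 0 * ρ ^ (2 ^ k) ≤ v (2 ^ k * n) := by
      intro k
      induction k with
      | zero =>
        rw [pow_zero, pow_one, one_mul, hρ, mul_div_cancel₀ _ h00.ne']
      | succ k ih =>
        have h1 := hsq (2 ^ k * n)
        rw [show 2 * (2 ^ k * n) = 2 ^ (k + 1) * n by ring] at h1
        have hpos : 0 ≤ v 0 * ρ ^ (2 ^ k) := by positivity
        have h3 : (v 0 * ρ ^ (2 ^ k)) ^ 2 ≤ v (2 ^ k * n) ^ 2 := pow_le_pow_left₀ hpos ih 2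
        have h4 : v 0 * ρ ^ (2 ^ (k + 1)) = (v 0 * ρ ^ (2 ^ k)) ^ 2 / v 0 := by
          rw [pow_succ, pow_mul]
          field_simp
        rw [h4, div_le_iff₀ h00]
        calc (v 0 * ρ ^ (2 ^ k)) ^ 2 ≤ v (2 ^ k * n) ^ 2 := h3
          _ ≤ v 0 * v (2 ^ (k + 1) * n) := h1
          _ = v (2 ^ (k + 1) * n) * v 0 := mul_comm _ _
    have hunb : Tendsto (fun k : ℕ => v 0 * ρ ^ (2 ^ k)) atTop atTop := by
      refine Tendsto.const_mul_atTop h00 ?_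
      refine tendsto_atTop_mono (fun k => ?_) (tendsto_pow_atTop_atTop_of_one_lt hρ1)
      exact pow_le_pow_right₀ hρ1.le Nat.lt_two_pow_self.le
    obtain ⟨k, hk⟩ := (hunb.eventually_gt_atTop C).exists
    exact absurd ((hiter k).trans (hC _)) (not_le.2 hk)

/-- **Exponential decay is inherited with the prefactor `u 0`.**  If `u ≥ 0` is log-convex
(`u(i+j)² ≤ u(2i) u(2j)`) and `u n ≤ C rⁿ` for some constant `C`, then `u n ≤ u 0 · rⁿ`:
for `u_a(n) = (ψ_a, T₁ⁿψ_a)` this is `(ψ, T₁ⁿψ) ≤ ‖ψ‖² e^{-κn}`, the content of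
"`σ(T₁) ∖ {1} ⊂ [0, e^{-κ}]`" used in (9). [cite: SalmhoferSeiler1992Erratum, (8)–(9)] -/
theorem le_head_mul_pow_of_logConvex {u : ℕ → ℝ} (h0 : ∀ n, 0 ≤ u n)
    (hconv : ∀ i j, u (i + j) ^ 2 ≤ u (2 * i) * u (2 * j)) {C r : ℝ} (hr : 0 < r)
    (hC : ∀ n, u n ≤ C * r ^ n) (n : ℕ) : u n ≤ u 0 * r ^ n := by
  set v : ℕ → ℝ := fun k => u k / r ^ k with hv
  have hv0 : ∀ k, 0 ≤ v k := fun k => div_nonneg (h0 k) (pow_nonneg hr.le k)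
  have hvconv : ∀ i j, v (i + j) ^ 2 ≤ v (2 * i) * v (2 * j) := by
    intro i j
    simp only [hv]
    rw [div_pow, div_mul_div_comm, ← pow_mul, ← pow_add, show (i + j) * 2 = 2 * i + 2 * j by ring]
    exact div_le_div_of_nonneg_right (hconv i j) (pow_nonneg hr.le _)
  have hvC : ∀ k, v k ≤ C := fun k => by
    simp only [hv]
    rw [div_le_iff₀ (pow_pos hr k)]
    exact hC k
  have h := le_head_of_logConvex_of_bounded hv0 hvconv hvC n
  simp only [hv, pow_zero, div_one] at h
  rwa [div_le_iff₀ (pow_pos hr n)] at h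

namespace IsRPState

variable {ω : A →ₗ[ℝ] ℝ} {θ τ : A →ₐ[ℝ] A} {S : Subalgebra ℝ A}

/-- **(9), diagonal form**: if `(ψ_a, T^nψ_a) ≤ C rⁿ` then `(ψ_a, Tⁿψ_a) ≤ (ψ_a, ψ_a) rⁿ`.
[cite: SalmhoferSeiler1992Erratum, (8)–(9)] -/
theorem corr_le (h : IsRPState ω θ τ S) {a : A} (ha : a ∈ S) {C r : ℝ} (hr : 0 < r)
    (hC : ∀ n, corr ω θ τ a n ≤ C * r ^ n) (n : ℕ) :
    corr ω θ τ a n ≤ ω (a * θ a) * r ^ n := by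
  rw [← corr_zero ω θ τ a]
  exact le_head_mul_pow_of_logConvex (h.corr_nonneg ha) (h.corr_sq_le ha) hr hC n

/-- **(9), off-diagonal form**: if `(ψ_a, Tⁿψ_a) ≤ C rⁿ` and `(ψ_b, Tⁿψ_b) ≤ C' rⁿ`, then
`|(ψ_a, Tⁿψ_b)| ≤ √((ψ_a,ψ_a)(ψ_b,ψ_b)) rⁿ`. [cite: SalmhoferSeiler1992Erratum, (9)] -/
theorem abs_cross_le (h : IsRPState ω θ τ S) {a b : A} (ha : a ∈ S) (hb : b ∈ S) {C C' r : ℝ}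
    (hr : 0 < r) (hC : ∀ n, corr ω θ τ a n ≤ C * r ^ n) (hC' : ∀ n, corr ω θ τ b n ≤ C' * r ^ n)
    (n : ℕ) :
    |ω (a * θ ((τ ^ (2 * n)) b))| ≤ Real.sqrt (ω (a * θ a) * ω (b * θ b)) * r ^ n := by
  have h1 := h.cross_sq_le ha hb n
  have ha0 : 0 ≤ ω (a * θ a) := h.nonneg a ha
  have hb0 : 0 ≤ ω (b * θ b) := h.nonneg b hb
  have h2 : corr ω θ τ a n * corr ω θ τ b n ≤ (ω (a * θ a) * r ^ n) * (ω (b * θ b) * r ^ n) :=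
    mul_le_mul (h.corr_le ha hr hC n) (h.corr_le hb hr hC' n) (h.corr_nonneg hb n)
      (mul_nonneg ha0 (pow_nonneg hr.le n))
  have h3 : ω (a * θ ((τ ^ (2 * n)) b)) ^ 2 ≤
      (Real.sqrt (ω (a * θ a) * ω (b * θ b)) * r ^ n) ^ 2 := by
    rw [mul_pow, Real.sq_sqrt (mul_nonneg ha0 hb0)]
    calc _ ≤ _ := h1.trans h2
      _ = _ := by ring
  exact abs_le_of_sq_le_sq' h3 (by positivity) |> fun h => abs_le.2 h

end IsRPState

end RPTransfer

/-! ### The NJL system on `ℤ^ν`: the infinite-volume state, its symmetries and reflection positivity -/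

namespace ComplexSpin

open Literature.Probability.LatticeModels (TorusSite Site)
open Literature.Probability.LatticeModels
open Literature.Barriers.CriticalPhenomena.NonGibbs
open RPTransfer

variable {ν : ℕ}

/-- The reflection `r` of `ℤ^ν` in the hyperplane `x_μ = -1/2` (between the layers `x_μ = -1` and
`x_μ = 0`): `(r x)_μ = -1 - x_μ`, the other coordinates fixed; `𝔏₊ = {x_μ ≥ 0}` is mapped onto
`{x_μ ≤ -1}`.  On the torus `(ℤ/L)^ν` this is the tree's `siteReflect μ 0` (Def. 3.13, plane
`k = 0`). [cite: SalmhoferSeiler1992Erratum, before (6) (`𝔏₊ = {x₁ ≥ 0}`)][cite: SalmhoferSeiler1991, Def. 3.13] -/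
def latReflect (μ : Fin ν) (x : Site ν) : Site ν := Function.update x μ (-1 - x μ)

/-- `(r x)_μ = -1 - x_μ`. [cite: SalmhoferSeiler1991, Def. 3.13] -/
@[simp] theorem latReflect_apply_same (μ : Fin ν) (x : Site ν) : latReflect μ x μ = -1 - x μ := by
  simp [latReflect]

/-- `(r x)_j = x_j` for `j ≠ μ`. [cite: SalmhoferSeiler1991, Def. 3.13] -/
theorem latReflect_apply_of_ne (μ : Fin ν) (x : Site ν) {j : Fin ν} (h : j ≠ μ) :
    latReflect μ x j = x j := by
  simp [latReflect, h]

/-- `r` is an involution. [cite: SalmhoferSeiler1991, Def. 3.13] -/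
@[simp] theorem latReflect_latReflect (μ : Fin ν) (x : Site ν) : latReflect μ (latReflect μ x) = x := by
  ext j
  by_cases h : j = μ
  · subst h; simp
  · simp [latReflect_apply_of_ne _ _ h]

/-- `r` commutes with the translations parallel to the plane: `r (x + y) = r x + y` if `y_μ = 0`.
[cite: SalmhoferSeiler1991, Def. 3.13] -/
theorem latReflect_add_of_apply_eq_zero (μ : Fin ν) (x : Site ν) {y : Site ν} (hy : y μ = 0) :
    latReflect μ (x + y) = latReflect μ x + y := by
  ext j
  by_cases h : j = μ
  · subst h; simp [hy]
  · simp [latReflect_apply_of_ne _ _ h]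

/-- `r (x + k e_μ) = r x - k e_μ`: across the plane the reflection reverses translations.
[cite: SalmhoferSeiler1991, Def. 3.13] -/
theorem latReflect_add_zsmul_single (μ : Fin ν) (x : Site ν) (k : ℤ) :
    latReflect μ (x + k • (Pi.single μ 1 : Site ν)) = latReflect μ x - k • (Pi.single μ 1 : Site ν) := by
  ext j
  by_cases h : j = μ
  · subst h; simp; ring
  · simp [latReflect_apply_of_ne _ _ h, h]

/-- `r (k e_μ) = -(k + 1) e_μ`. [cite: SalmhoferSeiler1991, Def. 3.13] -/
theorem latReflect_zsmul_single (μ : Fin ν) (k : ℤ) :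
    latReflect μ (k • (Pi.single μ 1 : Site ν)) = -(k + 1) • (Pi.single μ 1 : Site ν) := by
  have h := latReflect_add_zsmul_single μ 0 k
  rw [zero_add] at h
  rw [h]
  ext j
  by_cases hj : j = μ
  · subst hj; simp; ring
  · simp [latReflect_apply_of_ne _ _ hj, hj]

/-- Read on the torus, `r` is the tree's `siteReflect μ 0`. [cite: SalmhoferSeiler1991, Def. 3.13] -/
theorem proj_latReflect (L : ℕ) (μ : Fin ν) (x : Site ν) :
    Torus.proj L (latReflect μ x) = siteReflect μ 0 (Torus.proj L x) := by
  ext j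
  by_cases h : j = μ
  · subst h
    rw [siteReflect_apply_same, Torus.proj_apply, Torus.proj_apply, latReflect_apply_same]
    push_cast; ring
  · rw [siteReflect_apply_of_ne _ _ _ h, Torus.proj_apply, Torus.proj_apply,
      latReflect_apply_of_ne _ _ h]

/-- `Torus.proj` is additive. [cite: FriedliVelenik2017, §3.1] -/
theorem torusProj_add (L : ℕ) (x y : Site ν) : Torus.proj L (x + y) = Torus.proj L x + Torus.proj L y := by
  ext j; simp

/-! #### The infinite-volume state -/

/-- **The infinite-volume NJL state** on the real local observables of `ℤ^ν` (polynomials in the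
spins `σ_x`, `x ∈ ℤ^ν`): `⟨P⟩ = lim_{L→∞} ⟨P read on Λ_L⟩_{Λ_L}` along the tori `Λ_L = (ℤ/L)^ν`
(Thm. 3.8 / Cor. 3.9: for real `m ≠ 0` the limit exists along every sequence of tori and does not
depend on it, `tendsto_njlState`). [cite: SalmhoferSeiler1991, Thm. 3.8 (3.31) and Cor. 3.9] -/
def njlState (N : ℕ) (m : ℝ) (P : MvPolynomial (Site ν) ℝ) : ℝ :=
  limUnder atTop fun L : ℕ =>
    expect (ν := ν) (L := L + 1) N m (njlBondCoeff N) (rename (Torus.proj (L + 1)) P)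

/-- `⟨∑ Φ_b⟩_Λ = ∑ ⟨Φ_b⟩_Λ`. [cite: SalmhoferSeiler1991, (3.1)–(3.2)] -/
theorem expect_finsetSum {L : ℕ} [NeZero L] (N : ℕ) (m : ℝ) (a : ℕ → ℝ) {α : Type*} (s : Finset α)
    (Φ : α → MvPolynomial (TorusSite ν L) ℝ) :
    expect N m a (∑ b ∈ s, Φ b) = ∑ b ∈ s, expect N m a (Φ b) := by
  simp only [expect_eq_div, bracket_sum, Finset.sum_div]

/-- `⟨c Φ⟩_Λ = c ⟨Φ⟩_Λ`. [cite: SalmhoferSeiler1991, (3.1)–(3.2)] -/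
theorem expect_C_mul' {L : ℕ} [NeZero L] (N : ℕ) (m : ℝ) (a : ℕ → ℝ) (c : ℝ)
    (Φ : MvPolynomial (TorusSite ν L) ℝ) : expect N m a (C c * Φ) = c * expect N m a Φ := by
  rw [expect_eq_div, bracket_C_mul, mul_div_assoc, ← expect_eq_div]

/-- `⟨Φ + Ψ⟩_Λ = ⟨Φ⟩_Λ + ⟨Ψ⟩_Λ`. [cite: SalmhoferSeiler1991, (3.1)–(3.2)] -/
theorem expect_add' {L : ℕ} [NeZero L] (N : ℕ) (m : ℝ) (a : ℕ → ℝ)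
    (Φ Ψ : MvPolynomial (TorusSite ν L) ℝ) : expect N m a (Φ + Ψ) = expect N m a Φ + expect N m a Ψ := by
  rw [expect_eq_div, bracket_add, add_div, ← expect_eq_div, ← expect_eq_div]

/-- Translation invariance of `⟨·⟩_Λ` on the torus. [cite: SalmhoferSeiler1991, Def. 3.1 (torus)] -/
theorem expect_rename_addRight {L : ℕ} [NeZero L] (N : ℕ) (m : ℝ) (a : ℕ → ℝ) (c : TorusSite ν L)
    (Φ : MvPolynomial (TorusSite ν L) ℝ) :
    expect N m a (rename (fun x : TorusSite ν L => x + c) Φ) = expect N m a Φ := by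
  rw [expect_eq_div, bracket_rename_addRight, ← expect_eq_div]

/-- Reflection invariance of `⟨·⟩_Λ` on the torus (real form of `[ΘΦ] = conj [Φ]`).
[cite: SalmhoferSeiler1991, Remark 3.16] -/
theorem expect_reflectR {L : ℕ} [NeZero L] (i : Fin ν) (k : ZMod L) (N : ℕ) (m : ℝ) (a : ℕ → ℝ)
    (Φ : MvPolynomial (TorusSite ν L) ℝ) : expect N m a (reflectR i k Φ) = expect N m a Φ := by
  rw [expect_eq_div, bracket_reflectR, ← expect_eq_div]

/-- A finite-volume expectation of an observable read on the torus, as a finite sum over its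
monomials. [cite: SalmhoferSeiler1991, (3.1)–(3.2) and (3.31)] -/
theorem expect_rename_proj_eq_sum {L : ℕ} [NeZero L] (N : ℕ) (m : ℝ) (a : ℕ → ℝ)
    (P : MvPolynomial (Site ν) ℝ) :
    expect N m a (rename (Torus.proj L) P) =
      ∑ d ∈ P.support, coeff d P *
        expect N m a (monomial (Finsupp.mapDomain (Torus.proj L) d) (1 : ℝ)) := by
  conv_lhs => rw [P.as_sum, map_sum]
  rw [expect_finsetSum]
  refine Finset.sum_congr rfl fun d _ => ?_
  rw [rename_monomial, ← expect_C_mul', C_mul_monomial, mul_one]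

/-- Cor. 3.9 per monomial: `⟨σ^d⟩_{Λ_{L_j}}(m)` converges, for real `m ≠ 0`, along every sequence
of tori, to one and the same number. [cite: SalmhoferSeiler1991, Thm. 3.8 and Cor. 3.9] -/
theorem exists_tendsto_expect_monomial {N : ℕ} (hN : 1 ≤ N) (hν : 1 ≤ ν) {m : ℝ} (hm : m ≠ 0)
    (d : Site ν →₀ ℕ) :
    ∃ c : ℝ, ∀ (Ls : ℕ → ℕ) [∀ j, NeZero (Ls j)], Tendsto Ls atTop atTop →
      Tendsto (fun j => expect (ν := ν) (L := Ls j) N m (njlBondCoeff N)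
        (monomial (Finsupp.mapDomain (Torus.proj (Ls j)) d) (1 : ℝ))) atTop (𝓝 c) := by
  obtain ⟨f, -, h⟩ := njl_thermodynamicLimit_real hN hν d
  refine ⟨(f m).re, fun Ls _ hLs => ?_⟩
  have ht := h Ls hLs m hm
  simp_rw [njlCorrelation_ofReal] at ht
  refine ((Complex.continuous_re.tendsto _).comp ht).congr fun j => ?_
  simp only [Function.comp_apply, Complex.ofReal_re]

/-- The finite-volume expectations of a local observable read on the tori converge, for real
`m ≠ 0`, along every sequence of tori to one and the same number. [cite: SalmhoferSeiler1991, Thm. 3.8 (3.31) and Cor. 3.9] -/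
theorem exists_tendsto_expect_rename_proj {N : ℕ} (hN : 1 ≤ N) (hν : 1 ≤ ν) {m : ℝ} (hm : m ≠ 0)
    (P : MvPolynomial (Site ν) ℝ) :
    ∃ c : ℝ, ∀ (Ls : ℕ → ℕ) [∀ j, NeZero (Ls j)], Tendsto Ls atTop atTop →
      Tendsto (fun j => expect (ν := ν) (L := Ls j) N m (njlBondCoeff N)
        (rename (Torus.proj (Ls j)) P)) atTop (𝓝 c) := by
  classical
  choose c hc using fun d => exists_tendsto_expect_monomial hN hν hm d
  refine ⟨∑ d ∈ P.support, coeff d P * c d, fun Ls _ hLs => ?_⟩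
  simp_rw [expect_rename_proj_eq_sum]
  exact tendsto_finsetSum _ fun d _ => (hc d Ls hLs).const_mul _

/-- **Thm. 3.8 / Cor. 3.9 for the state**: for real `m ≠ 0`, `⟨P read on Λ_{L_j}⟩_{Λ_{L_j}} → ⟨P⟩`
along EVERY sequence of tori `L_j → ∞`. [cite: SalmhoferSeiler1991, Thm. 3.8 (3.31) and Cor. 3.9] -/
theorem tendsto_njlState {N : ℕ} (hN : 1 ≤ N) (hν : 1 ≤ ν) {m : ℝ} (hm : m ≠ 0)
    (P : MvPolynomial (Site ν) ℝ) (Ls : ℕ → ℕ) [∀ j, NeZero (Ls j)] (hLs : Tendsto Ls atTop atTop) :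
    Tendsto (fun j => expect (ν := ν) (L := Ls j) N m (njlBondCoeff N)
      (rename (Torus.proj (Ls j)) P)) atTop (𝓝 (njlState N m P)) := by
  obtain ⟨c, hc⟩ := exists_tendsto_expect_rename_proj hN hν hm P
  have h1 : njlState N m P = c := (hc (fun L => L + 1) (tendsto_add_atTop_nat 1)).limUnder_eq
  rw [h1]
  exact hc Ls hLs

/-- The even tori `L_j = 2j + 2`. [cite: SalmhoferSeiler1991, Def. 3.13 (even side lengths)] -/
theorem neZero_two_mul_add_two (j : ℕ) : NeZero (2 * j + 2) := ⟨by omega⟩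

/-- `2j + 2 → ∞`. [cite: SalmhoferSeiler1991, Thm. 3.8 (3.31)] -/
theorem tendsto_two_mul_add_two : Tendsto (fun j : ℕ => 2 * j + 2) atTop atTop := by
  refine tendsto_atTop_mono (fun j => ?_) tendsto_id
  simp only [id]; omega

/-- `⟨P + Q⟩ = ⟨P⟩ + ⟨Q⟩`. [cite: SalmhoferSeiler1991, Thm. 3.8 (3.31)] -/
theorem njlState_add {N : ℕ} (hN : 1 ≤ N) (hν : 1 ≤ ν) {m : ℝ} (hm : m ≠ 0)
    (P Q : MvPolynomial (Site ν) ℝ) : njlState N m (P + Q) = njlState N m P + njlState N m Q := by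
  have h := tendsto_njlState hN hν hm (P + Q) (fun L => L + 1) (tendsto_add_atTop_nat 1)
  simp_rw [map_add, expect_add'] at h
  exact tendsto_nhds_unique h ((tendsto_njlState hN hν hm P _ (tendsto_add_atTop_nat 1)).add
    (tendsto_njlState hN hν hm Q _ (tendsto_add_atTop_nat 1)))

/-- `⟨c P⟩ = c ⟨P⟩`. [cite: SalmhoferSeiler1991, Thm. 3.8 (3.31)] -/
theorem njlState_smul {N : ℕ} (hN : 1 ≤ N) (hν : 1 ≤ ν) {m : ℝ} (hm : m ≠ 0) (c : ℝ)
    (P : MvPolynomial (Site ν) ℝ) : njlState N m (c • P) = c * njlState N m P := by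
  have h := tendsto_njlState hN hν hm (c • P) (fun L => L + 1) (tendsto_add_atTop_nat 1)
  have h' : ∀ L : ℕ, expect (ν := ν) (L := L + 1) N m (njlBondCoeff N)
      (rename (Torus.proj (L + 1)) (c • P)) =
      c * expect (ν := ν) (L := L + 1) N m (njlBondCoeff N) (rename (Torus.proj (L + 1)) P) := by
    intro L
    rw [smul_eq_C_mul, map_mul, rename_C, expect_C_mul']
  simp_rw [h'] at h
  exact tendsto_nhds_unique h ((tendsto_njlState hN hν hm P _ (tendsto_add_atTop_nat 1)).const_mul c)

/-- `⟨1⟩ = 1` (`Z_Λ > 0` on the even tori at `m ≥ 0`). [cite: SalmhoferSeiler1991, (3.2) and Thm. 3.18 (1)] -/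
theorem njlState_one {N : ℕ} (hN : 1 ≤ N) (hν : 1 ≤ ν) {m : ℝ} (hm : 0 < m) :
    njlState (ν := ν) N m 1 = 1 := by
  haveI := neZero_two_mul_add_two
  have h := tendsto_njlState (ν := ν) hN hν hm.ne' 1 (fun j => 2 * j + 2) tendsto_two_mul_add_two
  refine tendsto_nhds_unique h (tendsto_const_nhds.congr fun j => ?_)
  rw [map_one, expect_one]
  exact (njl_partitionFunction_pos hν ⟨j + 1, by ring⟩ hN hm.le).ne'

/-- **The state as a linear functional** (real `m ≠ 0`). [cite: SalmhoferSeiler1991, Thm. 3.8 (3.31)] -/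
def njlStateL {N : ℕ} (hN : 1 ≤ N) (hν : 1 ≤ ν) {m : ℝ} (hm : m ≠ 0) :
    MvPolynomial (Site ν) ℝ →ₗ[ℝ] ℝ where
  toFun := njlState N m
  map_add' := njlState_add hN hν hm
  map_smul' := njlState_smul hN hν hm

/-- Unfolding `njlStateL`. [cite: SalmhoferSeiler1991, Thm. 3.8 (3.31)] -/
@[simp] theorem njlStateL_apply {N : ℕ} (hN : 1 ≤ N) (hν : 1 ≤ ν) {m : ℝ} (hm : m ≠ 0)
    (P : MvPolynomial (Site ν) ℝ) : njlStateL hN hν hm P = njlState N m P := rfl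

/-- **Translation invariance** of the infinite-volume state: `⟨τ_y P⟩ = ⟨P⟩`.
[cite: SalmhoferSeiler1992Erratum, after (6) ("by translation invariance")][cite: SalmhoferSeiler1991, Def. 3.1 (torus)] -/
theorem njlState_rename_add (N : ℕ) (m : ℝ) (y : Site ν) (P : MvPolynomial (Site ν) ℝ) :
    njlState N m (rename (fun x => x + y) P) = njlState N m P := by
  unfold njlState
  congr 1
  funext L
  rw [rename_rename]
  have h : (Torus.proj (L + 1) ∘ fun x => x + y) =
      (fun x : TorusSite ν (L + 1) => x + Torus.proj (L + 1) y) ∘ Torus.proj (L + 1) := by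
    funext x; simp [Function.comp_apply, torusProj_add]
  rw [h, ← rename_rename, expect_rename_addRight]

/-- **Reflection invariance** of the infinite-volume state: `⟨ΘP⟩ = ⟨P⟩` (real observables).
[cite: SalmhoferSeiler1991, Remark 3.16] -/
theorem njlState_rename_latReflect (N : ℕ) (m : ℝ) (μ : Fin ν) (P : MvPolynomial (Site ν) ℝ) :
    njlState N m (rename (latReflect μ) P) = njlState N m P := by
  unfold njlState
  congr 1
  funext L
  rw [rename_rename]
  have h : (Torus.proj (L + 1) ∘ latReflect μ) = siteReflect μ 0 ∘ Torus.proj (L + 1) := by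
    funext x; exact proj_latReflect _ _ _
  rw [h, ← rename_rename, ← reflectR_apply, expect_reflectR]

/-- A local observable of the half space `{x_μ ≥ 0}`, read on a torus wider than twice its extent,
lies in the positive-half algebra `𝒜_{Λ₊}` of the reflection plane `k = 0`.
[cite: SalmhoferSeiler1991, Def. 3.13 (3.47)] -/
theorem rename_proj_mem_plusAlgebraR {μ : Fin ν} {A : MvPolynomial (Site ν) ℝ}
    (hA : A ∈ supported ℝ {x : Site ν | 0 ≤ x μ}) {B : ℕ} (hB : ∀ x ∈ A.vars, x μ < B)
    {L : ℕ} [NeZero L] (hL : 2 * B ≤ L) :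
    rename (Torus.proj L) A ∈ plusAlgebraR (L := L) μ 0 := by
  classical
  rw [plusAlgebraR, mem_supported]
  intro z hz
  have hz' := vars_rename (Torus.proj L) A hz
  rw [Finset.mem_image] at hz'
  obtain ⟨x, hx, rfl⟩ := hz'
  have h0 : 0 ≤ x μ := mem_supported.1 hA (Finset.mem_coe.2 hx)
  have h1 : x μ < B := hB x hx
  rw [Finset.mem_coe, mem_halfPlus, sub_zero, Torus.proj_apply]
  have hval : (((x μ : ZMod L)).val : ℤ) = x μ := by
    rw [ZMod.val_intCast, Int.emod_eq_of_lt h0 (by omega)]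
  have h2 : ((x μ : ZMod L)).val < B := by
    have : (((x μ : ZMod L)).val : ℤ) < B := by rw [hval]; exact h1
    exact_mod_cast this
  omega

/-- **Reflection positivity of the infinite-volume state** (Prop. 3.15 in the limit): for a real
local observable `A` of the half space `𝔏₊ = {x_μ ≥ 0}`, `⟨A · ΘA⟩ ≥ 0` — the scalar product (6)
is positive semidefinite. [cite: SalmhoferSeiler1992Erratum, (6)][cite: SalmhoferSeiler1991, Prop. 3.15 (3.51)] -/
theorem njlState_mul_reflect_nonneg {N : ℕ} (hN : 1 ≤ N) (hν : 1 ≤ ν) {m : ℝ} (hm : m ≠ 0)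
    (μ : Fin ν) {A : MvPolynomial (Site ν) ℝ} (hA : A ∈ supported ℝ {x : Site ν | 0 ≤ x μ}) :
    0 ≤ njlState N m (A * rename (latReflect μ) A) := by
  classical
  haveI := neZero_two_mul_add_two
  have h := tendsto_njlState hN hν hm (A * rename (latReflect μ) A) (fun j => 2 * j + 2)
    tendsto_two_mul_add_two
  refine ge_of_tendsto h ?_
  -- a bound for the extent of `A` in direction `μ`
  obtain ⟨B, hB⟩ : ∃ B : ℕ, ∀ x ∈ A.vars, x μ < B := by
    refine ⟨(A.vars.sup fun x => (x μ).toNat) + 1, fun x hx => ?_⟩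
    have h1 : (x μ).toNat ≤ A.vars.sup fun x => (x μ).toNat := Finset.le_sup (f := fun x => (x μ).toNat) hx
    have h2 : x μ ≤ (x μ).toNat := Int.self_le_toNat _
    omega
  filter_upwards [eventually_ge_atTop B] with j hj
  have hmem := rename_proj_mem_plusAlgebraR hA hB (L := 2 * j + 2) (by omega)
  have hrefl : rename (Torus.proj (2 * j + 2)) (A * rename (latReflect μ) A) =
      rename (Torus.proj (2 * j + 2)) A * reflectR μ 0 (rename (Torus.proj (2 * j + 2)) A) := by
    have hfun : (Torus.proj (2 * j + 2) ∘ latReflect μ) =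
        (siteReflect μ (0 : ZMod (2 * j + 2)) ∘ Torus.proj (2 * j + 2)) :=
      funext fun x => proj_latReflect _ _ _
    rw [map_mul, rename_rename, reflectR_apply, rename_rename, hfun]
  rw [hrefl]
  exact expect_mul_reflectR_nonneg ⟨j + 1, by ring⟩ μ 0 m (fun k _ => by unfold njlBondCoeff; positivity) hmem

/-- **The NJL state is an RP state with transfer step** in every direction `μ`: the data (6) of the
Erratum — `ω = ⟨·⟩`, `Θ` = reflection in `x_μ = -1/2`, `τ` = translation by `e_μ`,
`S` = observables of `{x_μ ≥ 0}`. [cite: SalmhoferSeiler1992Erratum, (6) and the paragraph after it][cite: SalmhoferSeiler1991, Prop. 3.15 and Remark 3.16] -/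
theorem isRPState_njlState {N : ℕ} (hN : 1 ≤ N) (hν : 1 ≤ ν) {m : ℝ} (hm : m ≠ 0) (μ : Fin ν) :
    IsRPState (njlStateL (ν := ν) hN hν hm) (rename (latReflect μ))
      (rename fun x : Site ν => x + Pi.single μ 1) (supported ℝ {x : Site ν | 0 ≤ x μ}) where
  symm a b := by
    rw [njlStateL_apply, njlStateL_apply, ← njlState_rename_latReflect N m μ (a * rename _ b),
      map_mul, rename_rename]
    have : (latReflect μ ∘ latReflect μ) = id := by funext x; simp
    rw [this, rename_id, mul_comm]
    rfl
  nonneg a ha := by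
    rw [njlStateL_apply]
    exact njlState_mul_reflect_nonneg hN hν hm μ ha
  shift a b := by
    rw [njlStateL_apply, njlStateL_apply,
      ← njlState_rename_add N m (-(Pi.single μ 1 : Site ν)) (rename _ a * rename _ b), map_mul,
      rename_rename, rename_rename, rename_rename]
    have h1 : ((fun x : Site ν => x + -Pi.single μ 1) ∘ fun x : Site ν => x + Pi.single μ 1) = id := by
      funext x; simp
    have h2 : ((fun x : Site ν => x + -Pi.single μ 1) ∘ latReflect μ) =
        (latReflect μ ∘ fun x : Site ν => x + Pi.single μ 1) := by
      funext x
      simp only [Function.comp_apply]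
      have := latReflect_add_zsmul_single μ x 1
      rw [one_zsmul] at this
      rw [this, sub_eq_add_neg]
    rw [h1, rename_id, h2]
    rfl
  map_mem a ha := by
    classical
    rw [mem_supported] at ha ⊢
    intro z hz
    have hz' := vars_rename _ a hz
    rw [Finset.mem_image] at hz'
    obtain ⟨x, hx, rfl⟩ := hz'
    have h0 : 0 ≤ x μ := ha (Finset.mem_coe.2 hx)
    simp only [Set.mem_setOf_eq, Pi.add_apply, Pi.single_eq_same]
    omega

/-! ### Erratum (5): the truncated two-point function of the NJL model at real mass -/

section TwoPoint

/-- The infinite-volume two-point function `T(x) = ⟨σ_0 σ_x⟩` of the NJL model.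
[cite: SalmhoferSeiler1991, (3.100) and Thm. 3.23 (2)] -/
def njlTwoPoint (N : ℕ) (m : ℝ) (x : Site ν) : ℝ := njlState N m (X 0 * X x)

variable (ν) in
/-- The infinite-volume condensate `s = ⟨σ_0⟩ = ⟨σ_x⟩` of the NJL model.
[cite: SalmhoferSeiler1991, (3.111) and Thm. 4.3] -/
def njlCondensate (N : ℕ) (m : ℝ) : ℝ := njlState N m (X (0 : Site ν))

/-- `⟨σ_y⟩ = ⟨σ_0⟩ = s` (translation invariance). [cite: SalmhoferSeiler1991, (3.111) (`s = ⟨σ_x⟩`)] -/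
theorem njlState_X (N : ℕ) (m : ℝ) (y : Site ν) : njlState N m (X y) = njlCondensate ν N m := by
  rw [njlCondensate, ← njlState_rename_add N m y (X 0), rename_X, zero_add]

/-- `⟨σ_p σ_q⟩ = T(q - p)` (translation invariance). [cite: SalmhoferSeiler1991, (3.100)] -/
theorem njlState_X_mul_X (N : ℕ) (m : ℝ) (p q : Site ν) :
    njlState N m (X p * X q) = njlTwoPoint N m (q - p) := by
  rw [njlTwoPoint, ← njlState_rename_add N m p (X 0 * X (q - p)), map_mul, rename_X, rename_X,
    zero_add, sub_add_cancel]

/-- `T(-x) = T(x)`. [cite: SalmhoferSeiler1991, (3.100)] -/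
theorem njlTwoPoint_neg (N : ℕ) (m : ℝ) (x : Site ν) : njlTwoPoint N m (-x) = njlTwoPoint N m x := by
  rw [njlTwoPoint, njlTwoPoint, ← njlState_rename_add N m (-x) (X 0 * X x), map_mul, rename_X,
    rename_X, zero_add, add_neg_cancel, mul_comm]

/-- The matrix elements of the observables `σ_p - s`, `σ_q - s`:
`⟨(σ_p - s)(σ_q - s)⟩ = T(q - p) - s²`. [cite: SalmhoferSeiler1992Erratum, (9) (`ψ` the state of `σ_0`, `P_Ω` removed)] -/
theorem njlState_obs_mul_obs {N : ℕ} (hN : 1 ≤ N) (hν : 1 ≤ ν) {m : ℝ} (hm : 0 < m) (p q : Site ν) :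
    njlState N m ((X p - C (njlCondensate ν N m)) * (X q - C (njlCondensate ν N m))) =
      njlTwoPoint N m (q - p) - njlCondensate ν N m ^ 2 := by
  set s := njlCondensate ν N m with hs
  have hexp : (X p - C s) * (X q - C s) =
      X p * X q - s • X p - s • X q + (s * s) • (1 : MvPolynomial (Site ν) ℝ) := by
    simp only [smul_eq_C_mul, map_mul, mul_one]
    ring
  have h := congr_arg (njlStateL (ν := ν) hN hν hm.ne') hexp
  simp only [map_add, map_sub, map_smul, njlStateL_apply, smul_eq_mul] at h
  rw [h, njlState_X_mul_X, njlState_X, njlState_X, njlState_one hN hν hm, ← hs]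
  ring

/-- `Torus.proj 0 = 0`. [cite: FriedliVelenik2017, §3.1] -/
theorem torusProj_zero (L : ℕ) : Torus.proj L (0 : Site ν) = 0 := by
  ext j; simp

/-- `Torus.proj e_μ = e_μ`. [cite: FriedliVelenik2017, §3.1] -/
theorem torusProj_single (L : ℕ) (μ : Fin ν) :
    Torus.proj L (Pi.single μ 1 : Site ν) = (Pi.single μ 1 : TorusSite ν L) := by
  ext j
  by_cases h : j = μ
  · subst h; simp
  · simp [Pi.single_eq_of_ne h]

/-- `σ_0σ_x` read on the torus. [cite: SalmhoferSeiler1991, (3.100)] -/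
theorem rename_proj_X_mul_X (L : ℕ) (x : Site ν) :
    rename (Torus.proj L) (X (0 : Site ν) * X x : MvPolynomial (Site ν) ℝ) =
      X (0 : TorusSite ν L) * X (Torus.proj L x) := by
  rw [map_mul, rename_X, rename_X, torusProj_zero]

/-- `σ_0σ_x` read on the torus is the monomial of `NJLExponentialClustering`. [cite: SalmhoferSeiler1991, (3.100)] -/
theorem monomial_proj_pair_eq (L : ℕ) (x : Site ν) :
    (monomial (Finsupp.mapDomain (Torus.proj L) (Finsupp.single (0 : Site ν) 1 + Finsupp.single x 1))
      (1 : ℝ) : MvPolynomial (TorusSite ν L) ℝ) = rename (Torus.proj L) (X 0 * X x) := by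
  rw [rename_proj_X_mul_X, Finsupp.mapDomain_add, Finsupp.mapDomain_single,
    Finsupp.mapDomain_single, torusProj_zero, X, X, monomial_mul, mul_one]

/-- `σ_x` read on the torus. [cite: SalmhoferSeiler1991, (3.111)] -/
theorem monomial_proj_single_eq (L : ℕ) (x : Site ν) :
    (monomial (Finsupp.mapDomain (Torus.proj L) (Finsupp.single x 1)) (1 : ℝ) :
      MvPolynomial (TorusSite ν L) ℝ) = rename (Torus.proj L) (X x) := by
  rw [rename_X, Finsupp.mapDomain_single, X]

/-- **Thm. 3.11 / Erratum (1)–(2) in the infinite volume, with prefactor**: for real `m ≠ 0` there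
are `κ(m) > 0` and `C(m) ≥ 0` with `|T(x) - s²| ≤ C e^{-κ|x_μ|}` whenever `x_μ ≠ 0` (the tree's
`njl_twoPoint_exponentialClustering_limit` read for the state). [cite: SalmhoferSeiler1991, Thm. 3.11 (3.32)][cite: SalmhoferSeiler1992Erratum, (1)–(2)] -/
theorem abs_njlTwoPoint_sub_sq_le {N : ℕ} (hN : 1 ≤ N) (hν : 1 ≤ ν) {m : ℝ} (hm : m ≠ 0) :
    ∃ κ : ℝ, 0 < κ ∧ ∃ C : ℝ, 0 ≤ C ∧ ∀ (x : Site ν) (i : Fin ν), x i ≠ 0 →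
      |njlTwoPoint N m x - njlCondensate ν N m ^ 2| ≤ C * Real.exp (-κ * |(x i : ℝ)|) := by
  obtain ⟨κ, hκ, C, hC, hcl⟩ :=
    njl_twoPoint_exponentialClustering_limit (ν := ν) hN hν (ofReal_mem_njlMassRegion hm)
  refine ⟨κ, hκ, C, hC, fun x i hxi => ?_⟩
  have hsucc : Tendsto (fun L : ℕ => L + 1) atTop atTop := tendsto_add_atTop_nat 1
  have ha : Tendsto (fun j => njlCorrelation N (j + 1)
      (Finsupp.single (0 : Site ν) 1 + Finsupp.single x 1) (m : ℂ)) atTop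
      (𝓝 ((njlTwoPoint N m x : ℝ) : ℂ)) := by
    simp_rw [njlCorrelation_ofReal, monomial_proj_pair_eq]
    exact (Complex.continuous_ofReal.tendsto _).comp (tendsto_njlState hN hν hm _ _ hsucc)
  have hb : Tendsto (fun j => njlCorrelation N (j + 1) (Finsupp.single (0 : Site ν) 1) (m : ℂ))
      atTop (𝓝 ((njlCondensate ν N m : ℝ) : ℂ)) := by
    simp_rw [njlCorrelation_ofReal, monomial_proj_single_eq]
    exact (Complex.continuous_ofReal.tendsto _).comp (tendsto_njlState hN hν hm _ _ hsucc)
  have hc : Tendsto (fun j => njlCorrelation N (j + 1) (Finsupp.single x 1) (m : ℂ))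
      atTop (𝓝 ((njlCondensate ν N m : ℝ) : ℂ)) := by
    simp_rw [njlCorrelation_ofReal, monomial_proj_single_eq]
    rw [← njlState_X N m x]
    exact (Complex.continuous_ofReal.tendsto _).comp (tendsto_njlState hN hν hm _ _ hsucc)
  have h := hcl 0 x i (by simpa using hxi.symm) (fun L => L + 1) hsucc _ _ _ ha hb hc
  rw [← Complex.ofReal_mul, ← Complex.ofReal_sub, Complex.norm_real, Real.norm_eq_abs] at h
  simp only [Pi.zero_apply, zero_sub, Int.natAbs_neg] at h
  rw [sq]
  refine h.trans_eq ?_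
  rw [Nat.cast_natAbs, Int.cast_abs]

/-- **(4.10) ⇒ `T(e_μ) ≤ 1/2`** in finite volume: on an even torus at `m ≥ 0`,
`1 = 2m⟨σ_0⟩_Λ + ∑_{|y|=1} ⟨σ_0σ_y⟩_Λ` with all terms nonnegative and `⟨σ_0σ_{-e_μ}⟩ = ⟨σ_0σ_{e_μ}⟩`.
[cite: SalmhoferSeiler1991, (4.10) and Thm. 3.18 (1)] -/
theorem njl_expect_X_mul_X_single_le_half (hν : 1 ≤ ν) {N : ℕ} (hN : 1 ≤ N) {L : ℕ} [NeZero L]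
    (hL : Even L) {m : ℝ} (hm : 0 ≤ m) (μ : Fin ν) :
    expect N m (njlBondCoeff N) (X (0 : TorusSite ν L) * X (Pi.single μ 1)) ≤ 1 / 2 := by
  have hL2 : 2 ≤ L := by obtain ⟨k, hk⟩ := hL; have := NeZero.ne L; omega
  have hZ := njl_partitionFunction_pos hν hL hN hm (ν := ν) (L := L)
  have hsd := njl_partitionFunction_eq_sd (ν := ν) (L := L) hN hL2 m
  -- nonnegativity of all terms
  have hIcc : ∀ y : TorusSite ν L, 0 ≤ expect N m (njlBondCoeff N) (X (0 : TorusSite ν L) * X y) := by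
    intro y
    have h := expect_monomial_mem_Icc hν hL hL2 hN (hasLog_njl N) (njlBondCoeff_zero N) (by simp)
      (fun k hk _ => by rw [Pi.single_eq_of_ne (by omega : k ≠ 1)]) hm
      (Finsupp.single (0 : TorusSite ν L) 1 + Finsupp.single y 1)
    rw [show (X (0 : TorusSite ν L) * X y : MvPolynomial (TorusSite ν L) ℝ) =
      monomial (Finsupp.single 0 1 + Finsupp.single y 1) 1 by rw [X, X, monomial_mul, mul_one]]
    exact h.1
  have hs0 : 0 ≤ expect N m (njlBondCoeff N) (X (0 : TorusSite ν L)) := njl_expect_X_nonneg hν hL hN hm 0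
  -- the two neighbours `± e_μ` carry the same weight
  have hsym : expect N m (njlBondCoeff N) (X (0 : TorusSite ν L) * X (-Pi.single μ 1)) =
      expect N m (njlBondCoeff N) (X (0 : TorusSite ν L) * X (Pi.single μ 1)) := by
    rw [← expect_rename_addRight N m _ (Pi.single μ 1) (X 0 * X (-Pi.single μ 1)), map_mul,
      rename_X, rename_X, zero_add, neg_add_cancel, mul_comm]
  -- divide (4.10) by `Z`
  have h1 : 1 = 2 * m * expect N m (njlBondCoeff N) (X (0 : TorusSite ν L)) +
      ∑ μ' : Fin ν, (expect N m (njlBondCoeff N) (X (0 : TorusSite ν L) * X (Pi.single μ' 1)) +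
        expect N m (njlBondCoeff N) (X (0 : TorusSite ν L) * X (-Pi.single μ' 1))) := by
    have := congr_arg (fun t => t / partitionFunction (ν := ν) (L := L) N m (njlBondCoeff N)) hsd
    rw [div_self hZ.ne', add_div, Finset.sum_div] at this
    rw [this]
    congr 1
    · rw [expect_eq_div]; ring
    · refine Finset.sum_congr rfl fun μ' _ => ?_
      rw [add_div, twoPt, twoPt, ← expect_eq_div, ← expect_eq_div]
  have h2 : expect N m (njlBondCoeff N) (X (0 : TorusSite ν L) * X (Pi.single μ 1)) +
      expect N m (njlBondCoeff N) (X (0 : TorusSite ν L) * X (-Pi.single μ 1)) ≤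
      ∑ μ' : Fin ν, (expect N m (njlBondCoeff N) (X (0 : TorusSite ν L) * X (Pi.single μ' 1)) +
        expect N m (njlBondCoeff N) (X (0 : TorusSite ν L) * X (-Pi.single μ' 1))) :=
    Finset.single_le_sum (f := fun μ' => expect N m (njlBondCoeff N)
        (X (0 : TorusSite ν L) * X (Pi.single μ' 1)) +
      expect N m (njlBondCoeff N) (X (0 : TorusSite ν L) * X (-Pi.single μ' 1)))
      (fun μ' _ => add_nonneg (hIcc _) (hIcc _)) (Finset.mem_univ μ)
  rw [hsym] at h2
  have h3 : 0 ≤ 2 * m * expect N m (njlBondCoeff N) (X (0 : TorusSite ν L)) := by positivity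
  linarith

/-- **`T(e_μ) - s² ≤ 1/2`** in the infinite volume (limit of (4.10) along the even tori).
[cite: SalmhoferSeiler1991, (4.10) and Thm. 3.18 (1)] -/
theorem njlTwoPoint_single_le_half {N : ℕ} (hN : 1 ≤ N) (hν : 1 ≤ ν) {m : ℝ} (hm : 0 < m)
    (μ : Fin ν) : njlTwoPoint N m (Pi.single μ 1) ≤ 1 / 2 := by
  haveI := neZero_two_mul_add_two
  have h := tendsto_njlState hN hν hm.ne' (X (0 : Site ν) * X (Pi.single μ 1))
    (fun j => 2 * j + 2) tendsto_two_mul_add_two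
  refine le_of_tendsto' h fun j => ?_
  rw [rename_proj_X_mul_X, torusProj_single]
  exact njl_expect_X_mul_X_single_le_half hν hN ⟨j + 1, by ring⟩ hm.le μ

/-- `0 ≤ T(x) ≤ 1` and `0 ≤ s ≤ 1` in the infinite volume (Thm. 3.18 (1) in the limit), hence
`|T(x) - s²| ≤ 1`. [cite: SalmhoferSeiler1991, Thm. 3.18 (1) (3.59)] -/
theorem abs_njlTwoPoint_sub_sq_le_one {N : ℕ} (hN : 1 ≤ N) (hν : 1 ≤ ν) {m : ℝ} (hm : 0 < m)
    (x : Site ν) : |njlTwoPoint N m x - njlCondensate ν N m ^ 2| ≤ 1 := by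
  haveI := neZero_two_mul_add_two
  have hIcc : ∀ (j : ℕ) (d : TorusSite ν (2 * j + 2) →₀ ℕ),
      expect N m (njlBondCoeff N) (monomial d (1 : ℝ)) ∈ Set.Icc (0 : ℝ) 1 := fun j d =>
    expect_monomial_mem_Icc hν ⟨j + 1, by ring⟩ (by omega) hN (hasLog_njl N) (njlBondCoeff_zero N)
      (by simp) (fun k hk _ => by rw [Pi.single_eq_of_ne (by omega : k ≠ 1)]) hm.le d
  have hT : njlTwoPoint N m x ∈ Set.Icc (0 : ℝ) 1 := by
    have h := tendsto_njlState hN hν hm.ne' (X (0 : Site ν) * X x) (fun j => 2 * j + 2)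
      tendsto_two_mul_add_two
    refine isClosed_Icc.mem_of_tendsto h (Eventually.of_forall fun j => ?_)
    rw [← monomial_proj_pair_eq]
    exact hIcc j _
  have hs : njlCondensate ν N m ∈ Set.Icc (0 : ℝ) 1 := by
    have h := tendsto_njlState hN hν hm.ne' (X (0 : Site ν)) (fun j => 2 * j + 2)
      tendsto_two_mul_add_two
    refine isClosed_Icc.mem_of_tendsto h (Eventually.of_forall fun j => ?_)
    rw [← monomial_proj_single_eq]
    exact hIcc j _
  rw [abs_le]
  constructor <;> nlinarith [hT.1, hT.2, hs.1, hs.2]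

/-- Powers of the one-step translation on the observables `σ_x - c`.
[cite: SalmhoferSeiler1992Erratum, after (6) (`T₁` = translation by `2e₁`)] -/
theorem pow_rename_add_X_sub_C (μ : Fin ν) (k : ℕ) (x : Site ν) (c : ℝ) :
    ((rename fun y : Site ν => y + Pi.single μ 1) ^ k) (X x - C c : MvPolynomial (Site ν) ℝ) =
      X (x + (k : ℤ) • (Pi.single μ 1 : Site ν)) - C c := by
  induction k with
  | zero => simp
  | succ k ih =>
    rw [pow_succ', AlgHom.mul_apply, ih, map_sub, rename_X, rename_C]
    congr 2
    push_cast
    rw [add_smul, one_smul, add_assoc]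

/-- **Erratum (9) for the NJL model, one direction.**  For real `m > 0`, a direction `μ` and the
rate `κ` of Thm. 3.11: for all `x` with `x_μ ≥ 1`,
`|T(x) - s²| ≤ (T(e_μ) - s²) e^{-κ(x_μ - 1)}` — the transfer-operator bound
`|(ψ', (T₁^{n} - P_Ω) ψ)| ≤ ‖(1 - P_Ω)ψ‖² e^{-2κn}` with `ψ` the state of `σ_0` (and one Schwarz
inequality for even `x_μ`), `‖(1 - P_Ω)ψ‖² = T(e_μ) - s²`. [cite: SalmhoferSeiler1992Erratum, (8)–(9)] -/
theorem abs_njlTwoPoint_sub_sq_le_transfer {N : ℕ} (hN : 1 ≤ N) (hν : 1 ≤ ν) {m : ℝ} (hm : 0 < m)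
    (μ : Fin ν) {κ K : ℝ}
    (hcl : ∀ (x : Site ν), x μ ≠ 0 →
      |njlTwoPoint N m x - njlCondensate ν N m ^ 2| ≤ K * Real.exp (-κ * |(x μ : ℝ)|))
    (x : Site ν) (hx : 1 ≤ x μ) :
    |njlTwoPoint N m x - njlCondensate ν N m ^ 2| ≤
      (njlTwoPoint N m (Pi.single μ 1) - njlCondensate ν N m ^ 2) * Real.exp (-κ * ((x μ : ℝ) - 1)) := by
  -- the RP data in direction `μ`
  have hRP := isRPState_njlState (ν := ν) hN hν hm.ne' μ
  set ω := njlStateL (ν := ν) hN hν hm.ne' with hω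
  set θ : MvPolynomial (Site ν) ℝ →ₐ[ℝ] MvPolynomial (Site ν) ℝ := rename (latReflect μ) with hθ
  set τ : MvPolynomial (Site ν) ℝ →ₐ[ℝ] MvPolynomial (Site ν) ℝ :=
    rename fun y : Site ν => y + Pi.single μ 1 with hτ
  set S : Subalgebra ℝ (MvPolynomial (Site ν) ℝ) := supported ℝ {y : Site ν | 0 ≤ y μ} with hS
  set e : Site ν := Pi.single μ 1 with he
  set s : ℝ := njlCondensate ν N m with hs
  set g : Site ν → ℝ := fun y => njlTwoPoint N m y - s ^ 2 with hg
  have he0 : e μ = 1 := by simp [he]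
  -- membership of `σ_y - s` in `S` for `y_μ ≥ 0`
  have hmem : ∀ y : Site ν, 0 ≤ y μ → (X y - C s : MvPolynomial (Site ν) ℝ) ∈ S := by
    intro y hy
    refine S.sub_mem ?_ (Subalgebra.algebraMap_mem S s)
    rw [hS, mem_supported]
    intro z hz
    rw [Finset.mem_coe, vars_X] at hz
    rw [Finset.mem_singleton.1 hz]
    exact hy
  -- the generic matrix element: `ω((σ_p - s) θ τ^k (σ_q - s)) = g(r(q + k e) - p)`
  have helem : ∀ (p q : Site ν) (k : ℕ),
      ω ((X p - C s) * θ ((τ ^ k) (X q - C s))) = g (latReflect μ (q + (k : ℤ) • e) - p) := by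
    intro p q k
    rw [hτ, pow_rename_add_X_sub_C, hθ, map_sub, rename_X, rename_C, hω, njlStateL_apply, hs,
      njlState_obs_mul_obs hN hν hm]
  -- `r(k e) = -(k+1) e`, `r(y + k e) = y - (k+1) e` for `y_μ = 0`
  have hrefl : ∀ (y : Site ν) (k : ℕ), y μ = 0 →
      latReflect μ (y + (k : ℤ) • e) = y + (-((k : ℤ) + 1)) • e := by
    intro y k hy
    rw [add_comm y, latReflect_add_of_apply_eq_zero μ _ hy, he, latReflect_zsmul_single, add_comm]
  have hg_symm : ∀ y : Site ν, g (-y) = g y := fun y => by simp only [hg, njlTwoPoint_neg]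
  -- the diagonal elements of `A = σ_0 - s`: `u_A(n) = g((2n+1)e)`
  have hA : (X (0 : Site ν) - C s : MvPolynomial (Site ν) ℝ) ∈ S := hmem 0 (by simp)
  have hcorrA : ∀ n : ℕ, corr ω θ τ (X 0 - C s) n = g ((((2 * n : ℕ) : ℤ) + 1) • e) := by
    intro n
    rw [corr, helem, hrefl 0 _ (by simp), zero_add, sub_zero, ← hg_symm, ← neg_zsmul, neg_neg]
  -- the clustering input: `u_A(n) ≤ K e^{-κ} r^n`, `r = e^{-2κ}`
  set r : ℝ := Real.exp (-2 * κ) with hr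
  have hr0 : 0 < r := Real.exp_pos _
  have hge : ∀ (k : ℕ), g (((k : ℤ) + 1) • e) ≤ K * Real.exp (-κ) * Real.exp (-κ * k) := by
    intro k
    have h1 := hcl (((k : ℤ) + 1) • e) (by simp [he0]; omega)
    have h2 : |((((k : ℤ) + 1) • e) μ : ℝ)| = k + 1 := by
      simp only [Pi.smul_apply, he0, smul_eq_mul, mul_one]
      push_cast
      rw [abs_of_nonneg (by positivity)]
    rw [h2] at h1
    refine (le_abs_self _).trans (h1.trans_eq ?_)
    rw [mul_assoc, ← Real.exp_add]
    congr 2; ring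
  have hCA : ∀ n : ℕ, corr ω θ τ (X 0 - C s) n ≤ K * Real.exp (-κ) * r ^ n := by
    intro n
    rw [hcorrA]
    refine (hge (2 * n)).trans_eq ?_
    rw [hr, ← Real.exp_nat_mul]
    congr 2; push_cast; ring
  -- `u_A(0) = g(e)`
  have hA0 : ω ((X 0 - C s) * θ (X 0 - C s)) = g e := by
    have := hcorrA 0
    rw [corr_zero] at this
    rw [this]
    simp
  have hge0 : 0 ≤ g e := hA0 ▸ hRP.nonneg _ hA
  -- decompose `x = x' + x_μ e`, `x'_μ = 0`
  set x' : Site ν := x - (x μ) • e with hx'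
  have hx'μ : x' μ = 0 := by simp [hx', he0]
  obtain ⟨t, ht⟩ : ∃ t : ℕ, x μ = (t : ℤ) + 1 := ⟨(x μ - 1).toNat, by omega⟩
  have hxdecomp : x = x' + ((t : ℤ) + 1) • e := by rw [hx', ← ht, sub_add_cancel]
  rcases Nat.even_or_odd t with ⟨n, hn⟩ | ⟨n, hn⟩
  · -- `x_μ = 2n + 1`: `B = σ_{x'} - s`, `g(x) = ω(B θ τ^{2n} A)`
    have hB : (X x' - C s : MvPolynomial (Site ν) ℝ) ∈ S := hmem x' hx'μ.ge
    have hcorrB : ∀ k : ℕ, corr ω θ τ (X x' - C s) k = corr ω θ τ (X 0 - C s) k := by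
      intro k
      rw [corr, corr, helem, helem, hrefl x' _ hx'μ, hrefl 0 _ (by simp), zero_add, sub_zero,
        add_sub_cancel_left]
    have hcross := hRP.abs_cross_le hB hA hr0 (fun k => (hcorrB k).symm ▸ hCA k) hCA n
    rw [helem, hrefl 0 _ (by simp), zero_add, ← corr_zero ω θ τ, hcorrB 0, corr_zero, hA0,
      Real.sqrt_mul_self hge0] at hcross
    have hxe : (-(((2 * n : ℕ) : ℤ) + 1)) • e - x' = -x := by
      rw [hxdecomp, hn]
      ext j
      simp only [Pi.add_apply, Pi.sub_apply, Pi.neg_apply, Pi.smul_apply, smul_eq_mul]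
      push_cast; ring
    rw [hxe, hg_symm] at hcross
    refine hcross.trans_eq ?_
    rw [hr, ← Real.exp_nat_mul, ht, hn]
    congr 2; push_cast; ring
  · -- `x_μ = 2n + 2`: `B = σ_{x' + e} - s`, `g(x) = ω(B θ τ^{2n} A)`, `u_B(k) = u_A(k+1)`
    have hB : (X (x' + e) - C s : MvPolynomial (Site ν) ℝ) ∈ S := hmem (x' + e) (by simp [hx'μ, he0])
    have hcorrB : ∀ k : ℕ, corr ω θ τ (X (x' + e) - C s) k = corr ω θ τ (X 0 - C s) (k + 1) := by
      intro k
      have hxe : x' + e + ((2 * k : ℕ) : ℤ) • e = x' + (((2 * k + 1 : ℕ) : ℤ)) • e := by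
        push_cast
        rw [add_smul, one_smul, add_assoc, add_comm e]
      rw [corr, corr, helem, helem, hrefl 0 _ (by simp), zero_add, sub_zero, hxe, hrefl x' _ hx'μ]
      congr 1
      ext j
      simp only [Pi.add_apply, Pi.sub_apply, Pi.smul_apply, smul_eq_mul]
      push_cast; ring
    have hCB : ∀ k : ℕ, corr ω θ τ (X (x' + e) - C s) k ≤ K * Real.exp (-κ) * r * r ^ k := by
      intro k
      rw [hcorrB, mul_assoc _ r, ← pow_succ']
      exact hCA (k + 1)
    have hcross := hRP.abs_cross_le hB hA hr0 hCB hCA n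
    have hB0 : ω ((X (x' + e) - C s) * θ (X (x' + e) - C s)) ≤ g e * r := by
      rw [← corr_zero ω θ τ, hcorrB 0]
      exact (hRP.corr_le hA hr0 hCA 1).trans_eq (by rw [hA0, pow_one])
    have hxe : (-(((2 * n : ℕ) : ℤ) + 1)) • e - (x' + e) = -x := by
      rw [hxdecomp, hn]
      ext j
      simp only [Pi.add_apply, Pi.sub_apply, Pi.neg_apply, Pi.smul_apply, smul_eq_mul]
      push_cast; ring
    rw [helem, hrefl 0 _ (by simp), zero_add, hxe, hg_symm, hA0] at hcross
    have hsqrt : Real.sqrt (ω ((X (x' + e) - C s) * θ (X (x' + e) - C s)) * g e) ≤ g e * Real.sqrt r := by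
      calc _ ≤ Real.sqrt (g e * r * g e) := Real.sqrt_le_sqrt (mul_le_mul_of_nonneg_right hB0 hge0)
        _ = g e * Real.sqrt r := by
          rw [show g e * r * g e = r * (g e * g e) by ring, Real.sqrt_mul hr0.le,
            Real.sqrt_mul_self hge0, mul_comm]
    refine (hcross.trans (mul_le_mul_of_nonneg_right hsqrt (pow_nonneg hr0.le n))).trans_eq ?_
    have hsr : Real.sqrt r = Real.exp (-κ) := by
      rw [hr, ← Real.exp_half]; congr 1; ring
    rw [hsr, mul_assoc, hr, ← Real.exp_nat_mul, ← Real.exp_add, ht, hn]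
    congr 2; push_cast; ring

/-- **Erratum (5) (Salmhofer–Seiler): clustering of the truncated two-point function WITHOUT
prefactor at real mass.**  For the NJL model (`N ≥ 1` colours, `ν ≥ 1`) at real mass `m > 0`, in
the infinite volume: there is `κ(m) > 0` such that for ALL `x ∈ ℤ^ν`
`|⟨σ_0σ_x⟩ - ⟨σ_0⟩⟨σ_x⟩| ≤ e^{-κ(m)|x|}`, `|x| = max_i |x_i|` (stated coordinatewise: for every
`i`, `≤ e^{-κ(m)|x_i|}`).  Proof by the transfer-operator method of the Erratum ((6)–(9)):
reflection positivity of the infinite-volume state, `T₁ = τ_{2e_i}` symmetric and positive,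
log-convexity of `n ↦ (ψ, T₁ⁿψ)` in place of the spectral theorem, the rate from Thm. 3.11, and
`‖(1-P_Ω)ψ‖² = T(e_i) - s² ≤ 1/2` from (4.10). [cite: SalmhoferSeiler1992Erratum, (5)–(9)][cite: SalmhoferSeiler1991, Thm. 3.11, Prop. 3.15, Remark 3.16] -/
theorem njl_twoPoint_clustering_prefactorFree {N : ℕ} (hN : 1 ≤ N) (hν : 1 ≤ ν) {m : ℝ}
    (hm : 0 < m) :
    ∃ κ : ℝ, 0 < κ ∧ ∀ (x : Site ν) (i : Fin ν),
      |njlTwoPoint N m x - njlCondensate ν N m ^ 2| ≤ Real.exp (-κ * |(x i : ℝ)|) := by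
  obtain ⟨κ, hκ, K, -, hcl⟩ := abs_njlTwoPoint_sub_sq_le hN hν hm.ne'
  refine ⟨min κ (Real.log 2), lt_min hκ (Real.log_pos one_lt_two), fun x i => ?_⟩
  have hκ'κ : min κ (Real.log 2) ≤ κ := min_le_left _ _
  have hκ'2 : min κ (Real.log 2) ≤ Real.log 2 := min_le_right _ _
  have hhalf : (1 / 2 : ℝ) = Real.exp (-Real.log 2) := by
    rw [Real.exp_neg, Real.exp_log two_pos, one_div]
  -- positive `i`-th coordinate: the transfer-operator bound in direction `i`
  have hpos : ∀ y : Site ν, 1 ≤ y i →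
      |njlTwoPoint N m y - njlCondensate ν N m ^ 2| ≤ Real.exp (-min κ (Real.log 2) * (y i : ℝ)) := by
    intro y hy
    have h1 := abs_njlTwoPoint_sub_sq_le_transfer hN hν hm i (fun z hz => hcl z i hz) y hy
    have hge : njlTwoPoint N m (Pi.single i 1) - njlCondensate ν N m ^ 2 ≤ 1 / 2 := by
      nlinarith [njlTwoPoint_single_le_half hN hν hm i, sq_nonneg (njlCondensate ν N m)]
    have hy1 : (1 : ℝ) ≤ y i := by exact_mod_cast hy
    calc |njlTwoPoint N m y - njlCondensate ν N m ^ 2|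
        ≤ (1 / 2) * Real.exp (-κ * ((y i : ℝ) - 1)) :=
          h1.trans (mul_le_mul_of_nonneg_right hge (Real.exp_pos _).le)
      _ ≤ Real.exp (-min κ (Real.log 2) * (y i : ℝ)) := by
          rw [hhalf, ← Real.exp_add, Real.exp_le_exp]
          nlinarith
  rcases lt_trichotomy (x i) 0 with hlt | heq | hgt
  · have h := hpos (-x) (by simp only [Pi.neg_apply]; omega)
    rw [njlTwoPoint_neg] at h
    refine h.trans_eq ?_
    congr 1
    rw [Pi.neg_apply, Int.cast_neg, abs_of_neg (by exact_mod_cast hlt)]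
  · rw [heq, Int.cast_zero, abs_zero, mul_zero, Real.exp_zero]
    exact abs_njlTwoPoint_sub_sq_le_one hN hν hm x
  · have h := hpos x (by omega)
    rwa [abs_of_pos (by exact_mod_cast hgt : (0 : ℝ) < x i)]

/-- **Erratum (5) in the tree's finite-volume vocabulary.**  For the NJL system (`N ≥ 1`, `ν ≥ 1`),
real `m > 0` and ANY sequence of tori `Λ_n = (ℤ/L_n)^ν`, `L_n → ∞`: the limits
`T(x) = lim ⟨σ_0σ_{x̄}⟩_{Λ_n}` and `s = lim ⟨σ_{x̄}⟩_{Λ_n}` exist (Cor. 3.9) and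
`|T(x) - s²| ≤ e^{-κ(m)|x_i|}` for all `x ∈ ℤ^ν` and all `i`, some `κ(m) > 0` — no prefactor
(compare `njl_twoPoint_thermodynamicLimit`: `≤ C(m) e^{-κ|x_i|}`).
[cite: SalmhoferSeiler1992Erratum, (5)][cite: SalmhoferSeiler1991, Thm. 3.11 and Cor. 3.9] -/
theorem njl_twoPoint_clustering_prefactorFree_limit {N : ℕ} (hN : 1 ≤ N) (hν : 1 ≤ ν) {m : ℝ}
    (hm : 0 < m) (Ls : ℕ → ℕ) [∀ n, NeZero (Ls n)] (hLs : Tendsto Ls atTop atTop) :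
    ∃ T : Site ν → ℝ, ∃ s : ℝ,
      (∀ x : Site ν, Tendsto (fun n => expect (ν := ν) (L := Ls n) N m (njlBondCoeff N)
        (X 0 * X (Torus.proj (Ls n) x))) atTop (𝓝 (T x))) ∧
      (∀ x : Site ν, Tendsto (fun n => expect (ν := ν) (L := Ls n) N m (njlBondCoeff N)
        (X (Torus.proj (Ls n) x))) atTop (𝓝 s)) ∧
      ∃ κ : ℝ, 0 < κ ∧ ∀ (x : Site ν) (i : Fin ν), |T x - s ^ 2| ≤ Real.exp (-κ * |(x i : ℝ)|) := by
  refine ⟨njlTwoPoint N m, njlCondensate ν N m, fun x => ?_, fun x => ?_,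
    njl_twoPoint_clustering_prefactorFree hN hν hm⟩
  · have h := tendsto_njlState hN hν hm.ne' (X (0 : Site ν) * X x) Ls hLs
    simp_rw [rename_proj_X_mul_X] at h
    exact h
  · have h := tendsto_njlState hN hν hm.ne' (X x) Ls hLs
    simp_rw [rename_X] at h
    rw [← njlState_X N m x]
    exact h

end TwoPoint

end ComplexSpin

end Literature.MathematicalPhysics.StatisticalMechanics

end
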